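import Summits.BirchSwinnertonDyer.BirchSwinnertonDyer.Theorems.PrintCf2SplitBadTwoWeakLeopoldtAboveTowerMuInfty
import Literature.NumberTheory.IwasawaTheory.Greenberg2006.TwistDeformationLEO
import HarnessLib

/-!
# `H²(K_Σ/K̃_∞, A) ` is killed by a non-zero integer, for every finite-order rank-one scalar model
# at `p = 2` (crux `SplitBadTwoRankOneOfFacts`, stmt-BirchSwinnertonDyer-20368; road (γ), input hH2₂)

Cell `bsd-print-cf2`, width seat `bsd-line-cf2-p1-w2` gen 12, lane S3n′ (`stub_pseudoNullFinite_two`,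
skeleton v10.6).  The `p = 2` twin of the bsd-eis theorem
`Greenberg2006.restrict_galoisGroupAbove_H2_subsingleton_of_scalar` (TwistDeformationLEO.lean §2),
in the WEAK form that the engine of road (γ) actually consumes (LEO = cotorsion of `Ш²`, and
`corank_{Λ₂} H² = 0`):

* §1 `mem_iInf_ker_of_mem_torsion_of_mem_ker_four` — at `p = 2`: an automorphism whose `2`-adic
  cyclotomic character is TORSION (`= ±1`) and which fixes `μ₄` fixes every `2`-power root of unity
  (`−1 ≢ 1 mod 4`).  Hence `⋂ᵢ ker κᵢ ⊓ ker χ̄₄ ≤ ker χ₂` for a jointly surjective pair over an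
  imaginary quadratic `K` (`K̃_∞ ⊇ K^{cyc}`, tree `cyclotomicCharacter_mem_torsion_of_mem_multiZpKer`):
  `K̃_∞(i) = K̃_∞(μ_{2^∞})`.
* §2 **`exists_nsmul_H2_restrict_galoisGroupAbove_eq_zero_of_scalar`** — `K` imaginary quadratic,
  `S ⊇ {v ∣ 2}` finite places, `(κ₁, κ₂)` jointly onto `ℤ₂²`, `A ≃+ ℚ₂/ℤ₂` discrete, `ρ₀ : G_{K,S} → Aut A`
  continuous acting through a continuous character `θ : G_{K,S} →ₜ* ℤ₂ˣ` with FINITE image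
  (no «`2 ∤ #im θ`»!): **`∃ N ≠ 0, N • H²(Gal(K_Σ/K̃_∞), A) = 0`**.  Road: weak Leopoldt above
  `K_θ(i)K̃_∞(μ_{2^∞}) = K_θ(i)K̃_∞` (`subsingleton_H2_above_tower_muInfty` at the OPEN
  `U₀ := π⁻¹(ker θ) ∩ ker χ̄₄`, parity clause `Or.inr` (totally complex)) + transport along
  `Gal(K_Σ/K̃_∞K_θ(i)) ≅ U'' := ker(θ|) ∩ (image of ker χ̄₄)` (open in the profinite `Gal(K_Σ/K̃_∞)`,
  on which `ρ₀` IS trivial) + Serre I §2.4 Prop. 9 (`serre_prop9_ker_res_annihilated_by_index_holds`: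
  `ker Res` is killed by the index; here `Res = 0`).  At odd `p` / odd order the index is prime to `p`
  and one gets `H² = 0` (the bsd-eis theorem); at `p = 2` the index is a power of `2` times `#im θ`
  and the weak form is what survives — and suffices (sequel `…NoPseudoNullTwoOfFacts`).

Theorems only; no definition, no named fact, no `sorry`, no instance.  HONEST FRAMING: closes nothing
by itself (`--supports`); no summit statement / BSD / the crux is proved here.

References: [Greenberg2006] pp. 341–344, Thm. 3 p. 342; [SerreGaloisCohomology1997] I §2.4 Prop. 9;
[NeukirchSchmidtWingberg2008] (10.3.25); [Washington1997] §13.1, Thm. 13.4; [Serre1973] II §3.2 Prop. 8.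
-/

noncomputable section

open scoped Classical
open NumberField IsDedekindDomain Field
open Literature.NumberTheory.GaloisRepresentations
open Literature.NumberTheory.EllipticCurves (ZpExtension IsImaginaryQuadratic)
open Literature.NumberTheory.EllipticCurves.KellerYin2024 (continuousMonoidHom_isOpen_ker_of_finite_range)
open Literature.NumberTheory.IwasawaTheory Literature.NumberTheory.IwasawaTheory.Greenberg2006
open _root_.TopRep _root_.ContRepresentation _root_.ContinuousCohomology

set_option linter.dupNamespace false -- `Summit.BirchSwinnertonDyer.BirchSwinnertonDyer` (summit = problem) is the tree's layout

namespace Summit.BirchSwinnertonDyer.BirchSwinnertonDyer.Theorems.PrintCf2.WeakLeopoldtTwo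

variable {K : Type} [Field K] [NumberField K]

/-! ### §1. At `p = 2`: torsion cyclotomic character + fixing `μ₄` ⟹ fixing `μ_{2^∞}` -/

/-- **At `p = 2`, an automorphism with TORSION `2`-adic cyclotomic character which fixes `μ₄` fixes
every `2`-power root of unity**: `(ℤ₂ˣ)_{tors} = {±1}` (`u² = 1` in the domain `ℤ₂`), and `χ₂(σ) = −1`
would move a primitive fourth root of unity `ζ ↦ ζ³ = ζ⁻¹ ≠ ζ`. [cite: Serre1973, Ch. II §3.2 Prop. 8]
[cite: Washington1997, §13.1] -/
theorem mem_iInf_ker_of_mem_torsion_of_mem_ker_four {σ : absoluteGaloisGroup K}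
    (hσ : GaloisRep.cyclotomicCharacter K 2 σ ∈ CommGroup.torsion ℤ_[2]ˣ)
    (h4 : σ ∈ (modNCyclotomicCharacter K (2 ^ 2)).ker) :
    σ ∈ ⨅ k : ℕ, (modNCyclotomicCharacter K (2 ^ k)).ker := by
  have hroot := Literature.NumberTheory.EllipticCurves.PadicInt.torsion_units_le_rootsOfUnity
    (p := 2) hσ
  have ht : Literature.NumberTheory.EllipticCurves.torsionOrder 2 = 2 := by
    rw [Literature.NumberTheory.EllipticCurves.torsionOrder,
      Literature.NumberTheory.EllipticCurves.cyclotomicExponent, if_pos rfl]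
    decide
  rw [ht, mem_rootsOfUnity] at hroot
  have hsq : ((GaloisRep.cyclotomicCharacter K 2 σ : ℤ_[2]ˣ) : ℤ_[2]) *
      ((GaloisRep.cyclotomicCharacter K 2 σ : ℤ_[2]ˣ) : ℤ_[2]) = 1 := by
    rw [← Units.val_mul, ← sq, hroot, Units.val_one]
  rcases mul_self_eq_one_iff.mp hsq with h1 | hneg
  · exact mem_iInf_ker_modNCyclotomicCharacter_of_cyclotomicCharacter_eq_one 2 (Units.ext h1)
  · exfalso
    obtain ⟨ζ, hζ⟩ := HasEnoughRootsOfUnity.exists_primitiveRoot (AlgebraicClosure K) (2 ^ 2)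
    have hfix : σ • ζ = ζ := smul_eq_self_of_mem_ker_modNCyclotomicCharacter 2 h4 hζ.pow_eq_one
    have hspec := GaloisRep.cyclotomicCharacter_spec K 2 (k := 2) σ ζ hζ.pow_eq_one
    have hval : (PadicInt.toZModPow 2
        ((GaloisRep.cyclotomicCharacter K 2 σ : ℤ_[2]ˣ) : ℤ_[2])).val = 3 := by
      rw [hneg, map_neg, map_one]
      decide
    rw [hfix] at hspec
    change ζ = ζ ^ (PadicInt.toZModPow 2
        ((GaloisRep.cyclotomicCharacter K 2 σ : ℤ_[2]ˣ) : ℤ_[2])).val at hspec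
    rw [hval] at hspec
    have hζ0 : ζ ≠ 0 := hζ.ne_zero (by norm_num)
    have h2 : ζ ^ 2 = 1 := by
      have h3 : ζ ^ 2 * ζ = 1 * ζ := by rw [← pow_succ, one_mul]; exact hspec.symm
      exact mul_right_cancel₀ hζ0 h3
    have hdvd : (2 ^ 2 : ℕ) ∣ 2 := (hζ.pow_eq_one_iff_dvd 2).mp h2
    omega

/-- **`⋂ᵢ ker κᵢ ⊓ ker χ̄₄ ≤ ⋂ₖ ker χ̄_{2^k}`** whenever `χ₂` is torsion on `H = ⋂ᵢ ker κᵢ` (i.e.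
`K̃_∞ ⊇ K^{cyc}`): `K̃_∞(i) ⊇ μ_{2^∞}`. [cite: Washington1997, §13.1] -/
theorem inf_ker_four_le_iInf_ker (H : Subgroup (absoluteGaloisGroup K))
    (hcyc : ∀ σ : absoluteGaloisGroup K, σ ∈ H →
      GaloisRep.cyclotomicCharacter K 2 σ ∈ CommGroup.torsion ℤ_[2]ˣ) :
    H ⊓ (modNCyclotomicCharacter K (2 ^ 2)).ker ≤ ⨅ k : ℕ, (modNCyclotomicCharacter K (2 ^ k)).ker :=
  fun _ hσ ↦ mem_iInf_ker_of_mem_torsion_of_mem_ker_four (hcyc _ (Subgroup.mem_inf.mp hσ).1)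
    (Subgroup.mem_inf.mp hσ).2

/-! ### §2. `H²(K_Σ/K̃_∞, A)` is killed by a non-zero integer (`p = 2`, any finite-order scalar model) -/

section Descent

variable {S : Set (HeightOneSpectrum (𝓞 K))}

omit [NumberField K] in
/-- `Gal(K_Σ/∩) = ∩ Gal(K_Σ/·)` for TWO subgroups containing `N_S` (binary case of the tree's
`galoisGroupAbove_iInf`). [cite: Greenberg2006, p. 342 (display (2))] -/
theorem galoisGroupAbove_inf_eq (H₁ H₂ : Subgroup (absoluteGaloisGroup K))
    (h₁ : ramificationSubgroup K S ≤ H₁) :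
    galoisGroupAbove S (H₁ ⊓ H₂) = galoisGroupAbove S H₁ ⊓ galoisGroupAbove S H₂ := by
  refine le_antisymm (le_inf (Subgroup.map_mono inf_le_left) (Subgroup.map_mono inf_le_right))
    fun g hg ↦ ?_
  obtain ⟨σ₁, hσ₁, hσ₁g⟩ := (mem_galoisGroupAbove_iff S _ _).mp (Subgroup.mem_inf.mp hg).1
  obtain ⟨σ₂, hσ₂, hσ₂g⟩ := (mem_galoisGroupAbove_iff S _ _).mp (Subgroup.mem_inf.mp hg).2
  refine (mem_galoisGroupAbove_iff S _ _).mpr ⟨σ₂, Subgroup.mem_inf.mpr ⟨?_, hσ₂⟩, hσ₂g⟩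
  have h1 : toUnramifiedQuot K S (σ₁⁻¹ * σ₂) = 1 := by
    rw [map_mul, map_inv, hσ₁g, hσ₂g, inv_mul_cancel]
  have hmem : σ₁⁻¹ * σ₂ ∈ ramificationSubgroup K S := (QuotientGroup.eq_one_iff _).mp h1
  simpa using H₁.mul_mem hσ₁ (h₁ hmem)

omit [NumberField K] in
/-- The image in `G_{K,S}` of an OPEN subgroup of `Γ_K` is open (the quotient map is open). [folklore] -/
theorem isOpen_galoisGroupAbove (H : Subgroup (absoluteGaloisGroup K))
    (hH : IsOpen (H : Set (absoluteGaloisGroup K))) :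
    IsOpen ((galoisGroupAbove S H : Subgroup (GaloisGroupUnramifiedOutside K S)) :
      Set (GaloisGroupUnramifiedOutside K S)) := by
  have h : ((galoisGroupAbove S H : Subgroup (GaloisGroupUnramifiedOutside K S)) :
      Set (GaloisGroupUnramifiedOutside K S)) = toUnramifiedQuot K S '' (H : Set (absoluteGaloisGroup K)) := by
    ext g
    simp [mem_galoisGroupAbove_iff]
  rw [h]
  exact QuotientGroup.isOpenMap_coe _ hH

/-- **`∃ N ≠ 0, N • H²(Gal(K_Σ/K̃_∞), A) = 0` at `p = 2` for EVERY finite-order rank-one scalar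
model** — `K` imaginary quadratic, `S ⊇ {v ∣ 2}` (finite places), `(κ₁, κ₂)` jointly onto `ℤ₂²`
(`K̃_∞ = K̄^{ker κ₁ ∩ ker κ₂} ⊇ K^{cyc}`), `A` a discrete `ℤ₂`-module `≃+ ℚ₂/ℤ₂`, `ρ₀ : G_{K,S} → Aut A`
continuous with `ρ₀ g a = θ g • a` for a continuous `θ : G_{K,S} →ₜ* ℤ₂ˣ` of FINITE image.  Road:
weak Leopoldt above `K_θ(i)K̃_∞ ⊇ μ_{2^∞}` (`subsingleton_H2_above_tower_muInfty`, totally complex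
clause, at the open `U₀ = π⁻¹(ker θ) ∩ ker χ̄₄`; §1 removes the adjoined `μ_{2^∞}`), transport to the
open subgroup `U'' = ker(θ|) ∩ (ker χ̄₄)‾` of the profinite `Gal(K_Σ/K̃_∞)` on which `ρ₀` is trivial,
and Serre I §2.4 Prop. 9: `res_{U''} = 0` on `H²`, so `(Gal(K_Σ/K̃_∞) : U'') • H² = 0`.
[cite: Greenberg2006, pp. 343–344, Thm. 3 p. 342] [cite: SerreGaloisCohomology1997, Ch. I §2.4, Proposition 9]
[cite: Washington1997, Thm. 13.4] -/
theorem exists_nsmul_H2_restrict_galoisGroupAbove_eq_zero_of_scalar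
    (hK : IsImaginaryQuadratic K)
    (hS : ∀ v : HeightOneSpectrum (𝓞 K), ((2 : ℕ) : 𝓞 K) ∈ v.asIdeal → v ∈ S)
    (κ₁ κ₂ : ZpExtension K 2)
    (hκ : Function.Surjective fun σ : absoluteGaloisGroup K ↦ (κ₁ σ, κ₂ σ))
    {A : Type} [AddCommGroup A] [Module ℤ_[2] A] [TopologicalSpace A] [DiscreteTopology A]
    [ContinuousSMul ℤ_[2] A] (hA : Nonempty (A ≃+ ℚ_[2] ⧸ (PadicInt.subring 2).toAddSubgroup))
    (ρ₀ : ContinuousRep (GaloisGroupUnramifiedOutside K S) ℤ_[2] A)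
    (θ : GaloisGroupUnramifiedOutside K S →ₜ* ℤ_[2]ˣ)
    (hρ₀ : ∀ (g : GaloisGroupUnramifiedOutside K S) (a : A), ρ₀ g a = ((θ g : ℤ_[2]ˣ) : ℤ_[2]) • a)
    (hθ : (Set.range θ).Finite) :
    ∃ N : ℕ, N ≠ 0 ∧
      ∀ x : (ρ₀.restrict (galoisGroupAboveSubtype S (multiZpKer 2 ![κ₁, κ₂]))).H 2, N • x = 0 := by
  -- notation
  set Hsub : Subgroup (absoluteGaloisGroup K) := multiZpKer 2 ![κ₁, κ₂] with hHsub
  set Ginf : Subgroup (GaloisGroupUnramifiedOutside K S) := galoisGroupAbove S Hsub with hGinf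
  set ι : Ginf →ₜ* GaloisGroupUnramifiedOutside K S := galoisGroupAboveSubtype S Hsub with hι
  set Kθ : Subgroup (GaloisGroupUnramifiedOutside K S) := θ.toMonoidHom.ker with hKθ
  set F4 : Subgroup (absoluteGaloisGroup K) := (modNCyclotomicCharacter K (2 ^ 2)).ker with hF4
  set U₀ : Subgroup (absoluteGaloisGroup K) := Kθ.comap (toUnramifiedQuot K S) ⊓ F4 with hU₀
  -- openness and `N_S ≤ U₀`
  have hKθopen : IsOpen (Kθ : Set (GaloisGroupUnramifiedOutside K S)) :=
    continuousMonoidHom_isOpen_ker_of_finite_range θ hθ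
  have hF4open : IsOpen (F4 : Set (absoluteGaloisGroup K)) := isOpen_ker_modNCyclotomicCharacter 2 2
  have hU₀open : IsOpen (U₀ : Set (absoluteGaloisGroup K)) :=
    (hKθopen.preimage (continuous_toUnramifiedQuot K S)).inter hF4open
  have hNKθ : ramificationSubgroup K S ≤ Kθ.comap (toUnramifiedQuot K S) := fun σ hσ ↦ by
    rw [Subgroup.mem_comap, MonoidHom.mem_ker]
    have h1 : toUnramifiedQuot K S σ = 1 := (QuotientGroup.eq_one_iff σ).mpr hσ
    rw [h1, map_one]
  have hNF4 : ramificationSubgroup K S ≤ F4 := ramificationSubgroup_le_ker_modNCyclotomicCharacter 2 S hS 2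
  have hN : ramificationSubgroup K S ≤ U₀ := le_inf hNKθ hNF4
  have hNH : ramificationSubgroup K S ≤ Hsub := ramificationSubgroup_le_multiZpKer S 2 _ hS
  -- weak Leopoldt above `K_θ(i)K̃_∞(μ_{2^∞})`
  haveI := hK.2
  have hwl₀ : Subsingleton ((ContinuousRep.trivial (galoisGroupAbove S
      ((U₀ ⊓ Hsub) ⊓ ⨅ k : ℕ, (modNCyclotomicCharacter K (2 ^ k)).ker)) ℤ_[2] A).H 2) :=
    subsingleton_H2_above_tower_muInfty 2 S (Or.inr hK.2) hS ![κ₁, κ₂] U₀ hU₀open hN (R := ℤ_[2]) hA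
  -- `K_θ(i)K̃_∞ ⊇ μ_{2^∞}`: drop the adjoined roots of unity
  have hcyc := cyclotomicCharacter_mem_torsion_of_mem_multiZpKer (p := 2) hK hκ
  have hle : U₀ ⊓ Hsub ≤ ⨅ k : ℕ, (modNCyclotomicCharacter K (2 ^ k)).ker := fun σ hσ ↦
    inf_ker_four_le_iInf_ker Hsub hcyc
      (Subgroup.mem_inf.mpr ⟨(Subgroup.mem_inf.mp hσ).2, (Subgroup.mem_inf.mp (Subgroup.mem_inf.mp hσ).1).2⟩)
  have hsubeq : (U₀ ⊓ Hsub) ⊓ (⨅ k : ℕ, (modNCyclotomicCharacter K (2 ^ k)).ker) = U₀ ⊓ Hsub :=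
    inf_eq_left.mpr hle
  have hwl : Subsingleton ((ContinuousRep.trivial (galoisGroupAbove S (U₀ ⊓ Hsub)) ℤ_[2] A).H 2) :=
    subsingleton_H2_trivial_congr (congrArg (galoisGroupAbove S) hsubeq) hwl₀
  -- the open subgroup `U''` of `Ginf` killed by `θ` and fixing `μ₄`
  set U'' : Subgroup Ginf := (θ.comp ι).toMonoidHom.ker ⊓ (galoisGroupAbove S F4).subgroupOf Ginf
    with hU''
  have hGF : galoisGroupAbove S (F4 ⊓ Hsub) = galoisGroupAbove S F4 ⊓ Ginf :=
    galoisGroupAbove_inf_eq F4 Hsub hNF4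
  have hU''eq : U'' = (Kθ ⊓ galoisGroupAbove S (F4 ⊓ Hsub)).subgroupOf Ginf := by
    ext u
    simp only [hU'', MonoidHom.mem_ker, ContinuousMonoidHom.coe_toMonoidHom, Subgroup.mem_subgroupOf,
      Subgroup.mem_inf, hKθ, hGF, SetLike.coe_mem, and_true]
    rfl
  have hU'eq : galoisGroupAbove S (U₀ ⊓ Hsub) = Kθ ⊓ galoisGroupAbove S (F4 ⊓ Hsub) := by
    rw [hU₀, inf_assoc]
    exact galoisGroupAbove_comap_inf θ (F4 ⊓ Hsub)
  have hleG : Kθ ⊓ galoisGroupAbove S (F4 ⊓ Hsub) ≤ Ginf :=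
    inf_le_right.trans (Subgroup.map_mono inf_le_right)
  -- `U'' ≃ₜ* galoisGroupAbove S (U₀ ⊓ Hsub)`
  let e₀ : U'' ≃* (galoisGroupAbove S (U₀ ⊓ Hsub)) :=
    ((MulEquiv.subgroupCongr hU''eq).trans (Subgroup.subgroupOfEquivOfLe hleG)).trans
      (MulEquiv.subgroupCongr hU'eq.symm)
  have he₀ : ∀ u : U'', ((e₀ u : galoisGroupAbove S (U₀ ⊓ Hsub)) : GaloisGroupUnramifiedOutside K S) =
      ((u : Ginf) : GaloisGroupUnramifiedOutside K S) := fun _ ↦ rfl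
  have he₀' : ∀ v : galoisGroupAbove S (U₀ ⊓ Hsub),
      (((e₀.symm v : U'') : Ginf) : GaloisGroupUnramifiedOutside K S) =
        (v : GaloisGroupUnramifiedOutside K S) := fun _ ↦ rfl
  let e : U'' ≃ₜ* (galoisGroupAbove S (U₀ ⊓ Hsub)) :=
    { e₀ with
      continuous_toFun := by
        refine Topology.IsInducing.subtypeVal.continuous_iff.mpr ?_
        show Continuous fun u : U'' ↦
          ((e₀ u : galoisGroupAbove S (U₀ ⊓ Hsub)) : GaloisGroupUnramifiedOutside K S)
        simp_rw [he₀]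
        exact continuous_subtype_val.comp continuous_subtype_val
      continuous_invFun := by
        refine Topology.IsInducing.subtypeVal.continuous_iff.mpr
          (Topology.IsInducing.subtypeVal.continuous_iff.mpr ?_)
        show Continuous fun v : galoisGroupAbove S (U₀ ⊓ Hsub) ↦
          (((e₀.symm v : U'') : Ginf) : GaloisGroupUnramifiedOutside K S)
        simp_rw [he₀']
        exact continuous_subtype_val }
  -- transport the vanishing to `U''` with the trivial action
  have htrivU'' : Subsingleton ((ContinuousRep.trivial U'' ℤ_[2] A).H 2) := by
    haveI : Subsingleton (continuousCohomology 2
        (ContinuousRep.trivial (galoisGroupAbove S (U₀ ⊓ Hsub)) ℤ_[2] A).toTopRep) := hwl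
    exact subsingleton_continuousCohomology_of_continuousMulEquiv e
      (X := (ContinuousRep.trivial U'' ℤ_[2] A).toTopRep)
      (Y := (ContinuousRep.trivial (galoisGroupAbove S (U₀ ⊓ Hsub)) ℤ_[2] A).toTopRep)
      (TopRep.ofHom ⟨ContinuousLinearMap.id ℤ_[2] A, fun _ ↦ rfl⟩)
      (TopRep.ofHom ⟨ContinuousLinearMap.id ℤ_[2] A, fun _ ↦ rfl⟩)
      (fun _ ↦ rfl) 2
  -- the restriction of `ρ₀` to `U''` IS the trivial module
  have hrestr : (ρ₀.restrict ι).restrict ⟨U''.subtype, continuous_subtype_val⟩ =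
      ContinuousRep.trivial U'' ℤ_[2] A := by
    refine ContinuousRep.ext fun u ↦ LinearMap.ext fun a ↦ ?_
    have hu : θ (ι (u : Ginf)) = 1 := (Subgroup.mem_inf.mp u.2).1
    change ρ₀ (ι (u : Ginf)) a = a
    rw [hρ₀, hu, Units.val_one, one_smul]
  -- Serre I §2.4 Prop. 9: `(Ginf : U'') • H² = 0`
  haveI : CompactSpace Ginf := compactSpace_galoisGroupAbove S Hsub (isClosed_multiZpKer 2 _)
  haveI : TotallyDisconnectedSpace (GaloisGroupUnramifiedOutside K S) :=
    totallyDisconnectedSpace_galoisGroupUnramifiedOutside S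
  have hU''open : IsOpen (U'' : Set Ginf) := by
    refine IsOpen.inter ?_ ?_
    · refine continuousMonoidHom_isOpen_ker_of_finite_range (θ.comp ι) (hθ.subset ?_)
      rintro _ ⟨u, rfl⟩
      exact ⟨ι u, rfl⟩
    · exact (isOpen_galoisGroupAbove F4 hF4open).preimage continuous_subtype_val
  haveI hsub : Subsingleton
      (((ρ₀.restrict ι).restrict ⟨U''.subtype, continuous_subtype_val⟩).H 2) := by
    rw [hrestr]; exact htrivU''
  refine ⟨U''.index, index_ne_zero_of_isOpen U'' hU''open, fun x ↦ ?_⟩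
  exact serre_prop9_ker_res_annihilated_by_index_holds Ginf U'' hU''open ℤ_[2] A (ρ₀.restrict ι) 2 x
    (Subsingleton.elim _ _)

/-- **hH2₂ʷ — the weak-Leopoldt input of the `p = 2` road (γ) in the binder shape of -w5 g4's cut
(`NoPseudoNullCut.noPseudoNull_of_facts_of_weakLeopoldt_of_bridge_at`, binder `hH2` at `p := 2`, with
«Subsingleton H²» weakened to «∃ N ≠ 0, N • H² = 0»)**: for `K` imaginary quadratic, `S ⊇ {v ∣ 2}`
finite, `(κ₁, κ₂)` jointly onto `ℤ₂²`, `A ≃ₗ[ℤ₂] ℚ₂/ℤ₂` discrete and an abstract rank-one scalar model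
`ρ₀` (`ρ₀ g = t • _`, `t ∈ ℤ₂ˣ`) of finite order `n > 0` (NO parity / coprimality condition on `n`),
`H²(Gal(K_Σ/K̃_∞), A)` is killed by a non-zero integer.  THE character of `ρ₀`
(`exists_character_of_scalar`) has finite image (`finite_range_of_pow_eq_one`); apply §2.
[cite: Greenberg2006, pp. 343–344, p. 342 L2–5] [cite: SerreGaloisCohomology1997, Ch. I §2.4, Proposition 9] -/
theorem exists_nsmul_H2_above_eq_zero_two :
    ∀ (K : Type) [Field K] [NumberField K],
      IsImaginaryQuadratic K →
      ∀ (S : Set (HeightOneSpectrum (𝓞 K))), S.Finite →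
        (∀ v : HeightOneSpectrum (𝓞 K), ((2 : ℕ) : 𝓞 K) ∈ v.asIdeal → v ∈ S) →
      ∀ (κ₁ κ₂ : ZpExtension K 2),
        (Function.Surjective fun σ : absoluteGaloisGroup K ↦ (κ₁ σ, κ₂ σ)) →
      ∀ (A : Type) [AddCommGroup A] [Module ℤ_[2] A] [TopologicalSpace A] [DiscreteTopology A]
        [ContinuousSMul ℤ_[2] A], Nonempty (A ≃ₗ[ℤ_[2]] QpModZp 2) →
      ∀ (ρ₀ : ContinuousRep (GaloisGroupUnramifiedOutside K S) ℤ_[2] A) (n : ℕ), 0 < n →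
        (∀ g : GaloisGroupUnramifiedOutside K S, ∃ t : ℤ_[2]ˣ, ∀ a : A, ρ₀ g a = (t : ℤ_[2]) • a) →
        (∀ g : GaloisGroupUnramifiedOutside K S, ρ₀ g ^ n = 1) →
      ∃ N : ℕ, N ≠ 0 ∧
        ∀ x : (ρ₀.restrict (galoisGroupAboveSubtype S (multiZpKer 2 ![κ₁, κ₂]))).H 2, N • x = 0 := by
  intro K _ _ hK S _ hS κ₁ κ₂ hκ A _ _ _ _ _ hA ρ₀ n hn hscalar hρn
  obtain ⟨e⟩ := hA
  obtain ⟨θ, hθ, hθn⟩ := exists_character_of_scalar e ρ₀ hscalar hn hρn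
  exact exists_nsmul_H2_restrict_galoisGroupAbove_eq_zero_of_scalar hK hS κ₁ κ₂ hκ
    ⟨e.toAddEquiv.trans (QpModZp.addEquivQuotientSubring 2)⟩ ρ₀ θ hθ
    (finite_range_of_pow_eq_one θ.toMonoidHom hn hθn)

end Descent

end Summit.BirchSwinnertonDyer.BirchSwinnertonDyer.Theorems.PrintCf2.WeakLeopoldtTwo

end
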